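import Literature.Probability.LatticeModels.PlaneRotatorPowerLawDecay
import Literature.Probability.LatticeModels.XYTorusFreeBoxComparison
import HarnessLib

/-!
# Automorphism invariance of plane-rotator bond energies; on the torus `(ℤ/Lℤ)²` all
# nearest-neighbour bond energies coincide

Topic `Literature/Probability/LatticeModels`. Folklore symmetry statements for the plane rotator
(classical XY model) with general bond couplings `J : ι → ℝ` on a finite bond system
`G : BondSystem V ι` (Gibbs weight `exp(∑_a J_a cos(θ_{tgt a} − θ_{src a}))` on `U(1)^V`, Haar
probability; the Ginibre model of the bond characters `BondSystem.bondChar`, J. Ginibre, Comm. Math.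
Phys. 16 (1970) 310, Example 4; S. Friedli, Y. Velenik, *Statistical Mechanics of Lattice Systems*
(CUP 2017), §3.1 (periodic boundary condition: "the torus is invariant under translations")):

* `BondSystem.ginibreExpect_reChar_bondChar_eq_of_automorphism` — if `(e, ê)` is an automorphism of
  the bond system (`e : V ≃ V`, `ê : ι ≃ ι`, `src ∘ ê = e ∘ src`, `tgt ∘ ê = e ∘ tgt`) preserving the
  couplings, then the bond energies `⟨cos(θ_{tgt a} − θ_{src a})⟩_J` of `a` and `ê a` are equal
  (relabelling `θ ↦ θ ∘ e` preserves the Haar measure, `pi_map_comp_injective`);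
* `torusXY_bondEnergy_eq` — for the nearest-neighbour plane rotator on the discrete torus `(ℤ/Lℤ)²`
  (`torusXY 2 L`: bonds `(z, i) : z → z + eᵢ`) with uniform coupling `K`, ALL bond energies are equal
  (translations `z ↦ z + c` and the transposition of the two coordinates are automorphisms).

Use: with the local energy bound of `PlaneRotatorEquipartitionBound.lean` (the four bonds at a site
share the energy `4K·E_L(K) ≤ 2(4K)²/(1 + 8K)`) this gives the per-bond bound `E_L(K) ≤ 8K/(1 + 8K)`
used by `PlaneRotatorEnergyRenormalizedDecay.lean` (cell `pub/hubbard-tc`, crux №2 classical half).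

## References

* J. Ginibre, Comm. Math. Phys. 16 (1970) 310–328, Example 4. [Ginibre1970]
* S. Friedli, Y. Velenik, *Statistical Mechanics of Lattice Systems*, CUP 2017, §3.1 (torus,
  translation invariance). [FriedliVelenik2017]
-/

noncomputable section

open MeasureTheory Finset
open scoped BigOperators

namespace Literature.Probability.LatticeModels

/-! ### Automorphism invariance of bond energies -/

namespace BondSystem

variable {V ι : Type*} (G : BondSystem V ι)

section Automorphism

variable [Fintype V] [Fintype ι] [MeasurableSpace Circle] [BorelSpace Circle]

omit [Fintype V] [Fintype ι] [MeasurableSpace Circle] [BorelSpace Circle] in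
/-- Relabelling the spins by `e` maps the bond character of `a` to that of `ê a` when `(e, ê)` is an
automorphism of the bond system. [cite: Ginibre1970, Example 4 (plane rotators)] -/
theorem bondChar_comp_equiv {e : V ≃ V} {ehat : ι ≃ ι} (hsrc : ∀ a, G.src (ehat a) = e (G.src a))
    (htgt : ∀ a, G.tgt (ehat a) = e (G.tgt a)) (a : ι) (θ : V → Circle) :
    G.bondChar a (fun v => θ (e v)) = G.bondChar (ehat a) θ := by
  rw [bondChar, bondChar, diffChar_apply, diffChar_apply, hsrc, htgt]

omit [Fintype V] [MeasurableSpace Circle] [BorelSpace Circle] in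
/-- The Gibbs weight is invariant under a coupling-preserving automorphism.
[cite: Ginibre1970, Example 4 (plane rotators)] -/
theorem ginibreWeight_comp_equiv {e : V ≃ V} {ehat : ι ≃ ι} (hsrc : ∀ a, G.src (ehat a) = e (G.src a))
    (htgt : ∀ a, G.tgt (ehat a) = e (G.tgt a)) {J : ι → ℝ} (hJ : ∀ a, J (ehat a) = J a)
    (θ : V → Circle) :
    ginibreWeight G.bondChar J (fun v => θ (e v)) = ginibreWeight G.bondChar J θ := by
  rw [ginibreWeight, ginibreWeight, ginibreHamiltonian, ginibreHamiltonian]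
  congr 1
  simp_rw [reChar, G.bondChar_comp_equiv hsrc htgt]
  calc ∑ a, J a * (((G.bondChar (ehat a)) θ : Circle) : ℂ).re
      = ∑ a, J (ehat a) * (((G.bondChar (ehat a)) θ : Circle) : ℂ).re := by simp_rw [hJ]
    _ = ∑ b, J b * (((G.bondChar b) θ : Circle) : ℂ).re :=
        Equiv.sum_comp ehat (fun b => J b * (((G.bondChar b) θ : Circle) : ℂ).re)

/-- **Automorphism invariance of the bond energies.** For a coupling-preserving automorphism
`(e, ê)` of the bond system, `⟨cos(θ_{tgt a} − θ_{src a})⟩_J = ⟨cos(θ_{tgt (ê a)} − θ_{src (ê a)})⟩_J`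
(relabelling `θ ↦ θ ∘ e` preserves the Haar measure of `U(1)^V` and the weight).
[cite: FriedliVelenik2017, §3.1 (periodic boundary condition, translation invariance)] -/
theorem ginibreExpect_reChar_bondChar_eq_of_automorphism {e : V ≃ V} {ehat : ι ≃ ι}
    (hsrc : ∀ a, G.src (ehat a) = e (G.src a)) (htgt : ∀ a, G.tgt (ehat a) = e (G.tgt a))
    {J : ι → ℝ} (hJ : ∀ a, J (ehat a) = J a) (a : ι) :
    ginibreExpect (torusHaar V) G.bondChar J (reChar (G.bondChar a)) =
      ginibreExpect (torusHaar V) G.bondChar J (reChar (G.bondChar (ehat a))) := by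
  set ρ : (V → Circle) → (V → Circle) := fun θ v => θ (e v) with hρ
  have hρm : Measurable ρ := measurable_pi_lambda _ fun v => measurable_pi_apply _
  have hmap : (torusHaar V).map ρ = torusHaar V := by
    unfold torusHaar
    exact pi_map_comp_injective _ e.injective
  have transport : ∀ {g : (V → Circle) → ℝ}, Continuous g →
      ∫ θ, g θ ∂torusHaar V = ∫ θ, g (ρ θ) ∂torusHaar V := by
    intro g hg
    conv_lhs => rw [← hmap]
    rw [integral_map hρm.aemeasurable hg.aestronglyMeasurable]
  have hwc : Continuous (ginibreWeight G.bondChar J) := continuous_ginibreWeight _ _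
  unfold ginibreExpect
  rw [transport (g := fun θ => reChar (G.bondChar a) θ * ginibreWeight G.bondChar J θ)
      ((continuous_reChar _).mul hwc), transport hwc]
  simp only [hρ, G.ginibreWeight_comp_equiv hsrc htgt hJ]
  congr 1
  refine integral_congr_ae (ae_of_all _ fun θ => ?_)
  simp only [reChar, G.bondChar_comp_equiv hsrc htgt]

end Automorphism

end BondSystem

/-! ### The torus: translations and the transposition -/

section Torus

variable {L : ℕ}

/-- Translation of the bonds of the torus: `(z, i) ↦ (z + c, i)`. [cite: FriedliVelenik2017, §3.1 (periodic boundary condition, translation invariance)] -/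
def torusBondTranslate (c : TorusSite 2 L) : TorusSite 2 L × Fin 2 ≃ TorusSite 2 L × Fin 2 :=
  Equiv.prodCongr (Equiv.addRight c) (Equiv.refl _)

/-- The transposition of the two coordinates of `(ℤ/Lℤ)²`. [cite: FriedliVelenik2017, §3.1 (periodic boundary condition, translation invariance)] -/
def torusTranspose : TorusSite 2 L ≃ TorusSite 2 L where
  toFun z := fun j => z (Equiv.swap 0 1 j)
  invFun z := fun j => z (Equiv.swap 0 1 j)
  left_inv z := by funext j; simp [Equiv.swap_apply_self]
  right_inv z := by funext j; simp [Equiv.swap_apply_self]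

/-- The transposition on bonds: `(z, i) ↦ (zᵀ, swap i)`. [cite: FriedliVelenik2017, §3.1 (periodic boundary condition, translation invariance)] -/
def torusBondTranspose : TorusSite 2 L × Fin 2 ≃ TorusSite 2 L × Fin 2 :=
  Equiv.prodCongr torusTranspose (Equiv.swap 0 1)

/-- `(z + eᵢ)ᵀ = zᵀ + e_{swap i}`. [cite: FriedliVelenik2017, §3.1 (periodic boundary condition, translation invariance)] -/
theorem torusTranspose_add_single (z : TorusSite 2 L) (i : Fin 2) :
    torusTranspose (z + Pi.single i 1) = torusTranspose z + Pi.single (Equiv.swap 0 1 i) 1 := by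
  funext j
  simp only [torusTranspose, Equiv.coe_fn_mk, Pi.add_apply]
  congr 1
  by_cases h : Equiv.swap 0 1 j = i
  · rw [h, Pi.single_eq_same]
    have : j = Equiv.swap 0 1 i := by rw [← h, Equiv.swap_apply_self]
    rw [this, Pi.single_eq_same]
  · rw [Pi.single_eq_of_ne h]
    have : j ≠ Equiv.swap 0 1 i := fun hj => h (by rw [hj, Equiv.swap_apply_self])
    rw [Pi.single_eq_of_ne this]

variable [NeZero L] [MeasurableSpace Circle] [BorelSpace Circle]

/-- The **bond energy** `E_L(K; b) = ⟨cos(θ_{z+eᵢ} − θ_z)⟩_{K,L}` of the bond `b = (z, i)` of the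
nearest-neighbour plane rotator on `(ℤ/Lℤ)²` at uniform coupling `K` (a Ginibre expectation of the
bond characters of `torusXY 2 L`). [cite: Ginibre1970, Example 4 (plane rotators)] -/
def torusXYBondEnergy (L : ℕ) [NeZero L] (K : ℝ) (b : TorusSite 2 L × Fin 2) : ℝ :=
  ginibreExpect (torusHaar (TorusSite 2 L)) (torusXY 2 L).bondChar (fun _ => K)
    (reChar ((torusXY 2 L).bondChar b))

/-- Translation invariance of the bond energies: `E(z, i) = E(z + c, i)`.
[cite: FriedliVelenik2017, §3.1 (periodic boundary condition, translation invariance)] -/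
theorem torusXYBondEnergy_translate (K : ℝ) (b : TorusSite 2 L × Fin 2) (c : TorusSite 2 L) :
    torusXYBondEnergy L K b = torusXYBondEnergy L K (b.1 + c, b.2) := by
  obtain ⟨z, i⟩ := b
  have h := (torusXY 2 L).ginibreExpect_reChar_bondChar_eq_of_automorphism
    (e := Equiv.addRight c) (ehat := torusBondTranslate c)
    (fun a => by simp [torusBondTranslate, torusXY])
    (fun a => by simp [torusBondTranslate, torusXY, add_right_comm]) (J := fun _ => K)
    (fun _ => rfl) (z, i)
  simpa [torusXYBondEnergy, torusBondTranslate] using h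

/-- Transposition invariance of the bond energies: `E(z, i) = E(zᵀ, swap i)`.
[cite: FriedliVelenik2017, §3.1 (periodic boundary condition, translation invariance)] -/
theorem torusXYBondEnergy_transpose (K : ℝ) (b : TorusSite 2 L × Fin 2) :
    torusXYBondEnergy L K b = torusXYBondEnergy L K (torusTranspose b.1, Equiv.swap 0 1 b.2) := by
  obtain ⟨z, i⟩ := b
  have h := (torusXY 2 L).ginibreExpect_reChar_bondChar_eq_of_automorphism
    (e := torusTranspose) (ehat := torusBondTranspose)
    (fun a => by simp [torusBondTranspose, torusXY])
    (fun a => by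
      simp only [torusBondTranspose, torusXY, Equiv.prodCongr_apply, Prod.map]
      exact (torusTranspose_add_single a.1 a.2).symm) (J := fun _ => K)
    (fun _ => rfl) (z, i)
  simpa [torusXYBondEnergy, torusBondTranspose] using h

/-- **All nearest-neighbour bond energies of the torus coincide**: for every `L`, `K` and all bonds
`b, b'` of `(ℤ/Lℤ)²`, `⟨cos(θ_{tgt b} − θ_{src b})⟩_{K,L} = ⟨cos(θ_{tgt b'} − θ_{src b'})⟩_{K,L}`.
[cite: FriedliVelenik2017, §3.1 (periodic boundary condition, translation invariance)] -/
theorem torusXYBondEnergy_eq (K : ℝ) (b b' : TorusSite 2 L × Fin 2) :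
    torusXYBondEnergy L K b = torusXYBondEnergy L K b' := by
  -- reduce both to the bond `(0, 0)`
  have h0 : ∀ b : TorusSite 2 L × Fin 2, torusXYBondEnergy L K b = torusXYBondEnergy L K (0, 0) := by
    intro b
    rw [torusXYBondEnergy_translate K b (-b.1), add_neg_cancel]
    have hi : b.2 = 0 ∨ b.2 = 1 := by
      rcases b with ⟨z, i⟩
      fin_cases i <;> simp
    rcases hi with hi | hi
    · rw [hi]
    · rw [hi, torusXYBondEnergy_transpose K ((0 : TorusSite 2 L), (1 : Fin 2))]
      have h1 : torusTranspose (0 : TorusSite 2 L) = 0 := by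
        funext j; simp [torusTranspose]
      have h2 : Equiv.swap (0 : Fin 2) 1 1 = 0 := by decide
      rw [h1, h2]
  rw [h0 b, h0 b']

end Torus

end Literature.Probability.LatticeModels

end
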